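import Summits.QuantumFields.YangMills.Theorems.UnitScaleTiltHalvingCombTorusTowerLevels
import Summits.QuantumFields.YangMills.Theorems.UnitScaleTiltHalvingCombStep
import HarnessLib

/-!
# Line H (`BirthV10.stub_halvingStep`, stmt-QuantumFields-19200) — LEMMA B-al-2 AT THE MEMBER, `hstep` DISCHARGED: ★★★ the comb tower IS the pulled torus double-bar tower up to
# the k-uniform second-order defect `240·c₁·δc²·ε₀²`, constants PINNED ([Balaban1985Averaging] (42)∕(89)∕(127), [Balaban1987RG1] (0.4))

Cell `ym3-torus` (HUMAN RULING D-0037: YM₃ on T³ is ladder rung R3 — NOT d = 4, NOT infinite volume, NOT a mass gap, NOT the Clay problem), width seat `ym3-torus-px15` gen 4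
(LEAD-H ★w5-19200 g7 WORD 21: (B-iv) STEP = px15, (B-v-tower) = px3 g5; this file is the KNIT of the two, offered on the bus 2026-08-29T04:42Z with first refusal to px3 g5).
`--supports stmt-QuantumFields-19200 --as helper`; THEOREMS ONLY (0 `def`, 0 `sorry`); count-neutral; nothing here claims the B-al-3 door, (B-al-4), `H42topCrossT`, (M2′), the stub,
the crux or the gap.

WHAT.  px3 g5's ✓`HalvingCombTorusTower.comb_eq_dbar_mul_defect_of_step[_inAx]` ∕ `…_levels_of_step[_inAx]` (the k-level induction, B-al-2 MODULO the level step `hstep`, free reals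
`A c₁ δc`) composed with
px15 g4's ✓`HalvingCombStep.norm_dbarAvgU_inv_mul_bavg_sub_one_le` (the level step `H_j ⇒ H_{j+1}`, = the `hstep` text at `A := 2((d+2)L + L + 2d⌊(L−1)∕2⌋)`,
`c₁ := C₂(d) + 40000(d+2)²`, `δc := (2dL+1)(d(L−1)+L)`): for the member `(F, n, K)`, `k = K − n`, `X̂ = (U^{gJ})♭`, `U′ = pull X̂ 0`,
  ★★★ `comb_eq_dbar_mul_defect` ∕ `comb_eq_dbar_mul_defect_inAx`: **`‖(dbarIterU k X̂ ⟨π_k z, ν⟩)⁻¹ · avgIter L U′ k z ν − 1‖ ≤ 240·c₁·δc²·ε₀²`** at EVERY top bond `(z, ν)` of `ℤ³`,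
under the socket guards (a) `InAk` on `univ` and (b) block-axiality below the top (`hblk`; twin (b′) `InAx`, w3-20520 g9's door letters) and the three scalar windows displayed at
the pinned constants (`hw1 : 10⁴·(d+2)L·(δc·4ε₀ + 2·240c₁δc²ε₀²) ≤ 1`, `hw2 : L·2·δc·4ε₀ ≤ c₄(d)`, `hA : 33·A ≤ 20·L⁴`, + Prop. 2's `hα3 hα2`) — NO `hstep`, NO gauge factor;
  ★★ `comb_eq_dbar_mul_defect_levels` ∕ `_levels_inAx`: the same AT EVERY LEVEL `j ≤ k` with the geometric factor `(Lʲ)⁴(Lᵏ)⁻⁴` (w3 g11's `hdef` row of ✓`HalvingDbarStairSizes`).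
HONEST SCOPE.  A two-line knit by name; the analysis is in the two cited files and their bricks (✓B-al-1, ✓(B-i)(B-ii), ✓(B-iii), w3 g10's geometry).  This is the MEMBER STATEMENT
of LEMMA B-al-2 the B-al-3 door ∕ (B-al-4) ∕ v10 packs consume; it is NOT the (b)-row itself, NOT `H42topCrossT`, NOT the stub.

References: T. Bałaban, CMP **98** (1985) 17–51 [Balaban1985Averaging] ((42)–(43) pp.23–24, Prop. 2 (54) p.26, (89) p.31, (127) p.36, Prop. 4 (134)–(135) pp.38–39);
CMP **109** (1987) 249–301 [Balaban1987RG1] ((0.1)–(0.4) pp.251–253); CMP **99** (1985) 75–102 [Balaban1985RegularSpaces] ((1.7) p.77).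
-/

set_option autoImplicit false

noncomputable section

open scoped BigOperators Matrix.Norms.L2Operator

namespace Summit.QuantumFields.YangMills.Theorems.HalvingCombTorusTowerOfStep

open Literature.MathematicalPhysics.QuantumFieldTheory.Balaban1983to89
open Literature.MathematicalPhysics.QuantumFieldTheory.Balaban1983to89.T3ContinuumYM3Torus
open B7Prop1Explicit renaming Site → LSite
open B7Prop1Explicit (e boxVec axialFn bavg U1)
open B7Prop2Explicit (avgIter C0 c2')
open B7Prop4Flat (C2 c4 C1_pos)
open B8Ineq132 (InAk)
open B8Eq119TwistedAxial (InAx)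
open B8Lemma1NonAbelian (PlaqSmall)
open B10Eq27TorusAxialLog (pull unitsField toUField)
open Node00 (coverAt)
open Summit.QuantumFields.YangMills.Theorems.Prop8ChartDoubleBar (dbarAvgU dbarIterU)
open HalvingCombTorusTower (comb_eq_dbar_mul_defect_of_step comb_eq_dbar_mul_defect_of_step_inAx comb_eq_dbar_mul_defect_levels_of_step
  comb_eq_dbar_mul_defect_levels_of_step_inAx)
open HalvingCombStep (norm_dbarAvgU_inv_mul_bavg_sub_one_le)

variable (F : T3Family) {n K : ℕ}

/-- ★★★ **LEMMA B-al-2 AT THE MEMBER (`hstep` discharged, constants pinned): the comb tower is the pulled torus double-bar tower up to `240·c₁·δc²·ε₀²`, no gauge factor.**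
`c₁ = C₂(d) + 40000(d+2)²`, `δc = (2dL+1)(d(L−1)+L)`, `A = 2((d+2)L + L + 2d⌊(L−1)∕2⌋)` in `hw1 hw2 hA`; guards (a) `InAk` on `univ`, (b) block-axiality below the top.
[cite: Balaban1985Averaging, (42)-(43) pp.23-24, Prop. 2 (54) p.26, (89) p.31, (127) p.36, Prop. 4 (134)-(135) pp.38-39; Balaban1987RG1, (0.4) p.253; Balaban1985RegularSpaces, (1.7) p.77] -/
theorem comb_eq_dbar_mul_defect (hnK : n < K) {ε₀ : ℝ} (hε₀ : 0 < ε₀)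
    (hα3 : C0 (F.P K).d * (2 * ε₀) ≤ 1 / 3) (hα2 : 2 * (2 * ε₀) ≤ c2' (F.P K).d (F.P K).L)
    (hw1 : 10 ^ 4 * ((((F.P K).d + 2) * (F.P K).L : ℕ) : ℝ) *
      ((((2 * ((F.P K).d * (F.P K).L) + 1) * ((F.P K).d * ((F.P K).L - 1) + (F.P K).L) : ℕ) : ℝ) * (4 * ε₀) +
        2 * (240 * (C2 (F.P K).d + 40000 * (((F.P K).d : ℝ) + 2) ^ 2) *
          (((2 * ((F.P K).d * (F.P K).L) + 1) * ((F.P K).d * ((F.P K).L - 1) + (F.P K).L) : ℕ) : ℝ) ^ 2 * ε₀ ^ 2)) ≤ 1)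
    (hw2 : ((F.P K).L : ℝ) * (2 * ((((2 * ((F.P K).d * (F.P K).L) + 1) * ((F.P K).d * ((F.P K).L - 1) + (F.P K).L) : ℕ) : ℝ) * (4 * ε₀))) ≤ c4 (F.P K).d)
    (hA : 33 * (2 * (((((F.P K).d + 2) * (F.P K).L : ℕ) : ℝ) + (F.P K).L + 2 * (((F.P K).d * (((F.P K).L - 1) / 2) : ℕ) : ℝ))) ≤ 20 * ((F.P K).L : ℝ) ^ 4)
    (U : GaugeField (F.P K) 0 (Matrix.specialUnitaryGroup (Fin 2) ℂ)) (gJ : GaugeTransf (F.P K) 0 (Matrix.specialUnitaryGroup (Fin 2) ℂ))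
    (hInAk : InAk (F.P K).L (K - n) (((F.L : ℝ)⁻¹) ^ (K - n)) ε₀ (fun _ => (Set.univ : Set (LSite (F.P K).d)))
      (pull (unitsField (toUField (GaugeField.gaugeAct gJ U))) 0))
    (hblk : ∀ m, m < K - n → ∀ (z : LSite (F.P K).d) (r : Fin (F.P K).d → Fin (F.P K).L),
      axialFn (avgIter (F.P K).L (pull (unitsField (toUField (GaugeField.gaugeAct gJ U))) 0) (K - n - (m + 1))) (((F.P K).L : ℤ) • z)
        (((F.P K).L : ℤ) • z + boxVec (F.P K).L r) = 1)
    (z : LSite (F.P K).d) (ν : Fin (F.P K).d) :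
    ‖(((dbarIterU (K - n) (unitsField (toUField (GaugeField.gaugeAct gJ U))) ⟨coverAt (F.P K) (K - n) z, ν⟩)⁻¹ *
          avgIter (F.P K).L (pull (unitsField (toUField (GaugeField.gaugeAct gJ U))) 0) (K - n) z ν : (Matrix (Fin 2) (Fin 2) ℂ)ˣ) :
        Matrix (Fin 2) (Fin 2) ℂ) - 1‖ ≤
      240 * (C2 (F.P K).d + 40000 * (((F.P K).d : ℝ) + 2) ^ 2) *
        (((2 * ((F.P K).d * (F.P K).L) + 1) * ((F.P K).d * ((F.P K).L - 1) + (F.P K).L) : ℕ) : ℝ) ^ 2 * ε₀ ^ 2 :=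
  comb_eq_dbar_mul_defect_of_step F hnK hε₀ (by have := C1_pos (F.P K).d; unfold C2; positivity) (Nat.cast_nonneg _)
    (fun j hj2 => norm_dbarAvgU_inv_mul_bavg_sub_one_le hj2) hα3 hα2 hw1 hw2 hA U gJ hInAk hblk z ν

/-- ★★★ **The same in the B-al-3 door's guard (b′)** `InAx` at every level on every family of regions (w3-20520 g9's letters), via px3 g5's ✓`hblk_of_inAx`.
[cite: Balaban1985Averaging, (42)-(43) pp.23-24, (89) p.31, (127) p.36, Prop. 4 (134)-(135) pp.38-39; Balaban1987RG1, (0.4) p.253; Balaban1985RegularSpaces, (1.7) p.77] -/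
theorem comb_eq_dbar_mul_defect_inAx (hnK : n < K) {ε₀ : ℝ} (hε₀ : 0 < ε₀)
    (hα3 : C0 (F.P K).d * (2 * ε₀) ≤ 1 / 3) (hα2 : 2 * (2 * ε₀) ≤ c2' (F.P K).d (F.P K).L)
    (hw1 : 10 ^ 4 * ((((F.P K).d + 2) * (F.P K).L : ℕ) : ℝ) *
      ((((2 * ((F.P K).d * (F.P K).L) + 1) * ((F.P K).d * ((F.P K).L - 1) + (F.P K).L) : ℕ) : ℝ) * (4 * ε₀) +
        2 * (240 * (C2 (F.P K).d + 40000 * (((F.P K).d : ℝ) + 2) ^ 2) *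
          (((2 * ((F.P K).d * (F.P K).L) + 1) * ((F.P K).d * ((F.P K).L - 1) + (F.P K).L) : ℕ) : ℝ) ^ 2 * ε₀ ^ 2)) ≤ 1)
    (hw2 : ((F.P K).L : ℝ) * (2 * ((((2 * ((F.P K).d * (F.P K).L) + 1) * ((F.P K).d * ((F.P K).L - 1) + (F.P K).L) : ℕ) : ℝ) * (4 * ε₀))) ≤ c4 (F.P K).d)
    (hA : 33 * (2 * (((((F.P K).d + 2) * (F.P K).L : ℕ) : ℝ) + (F.P K).L + 2 * (((F.P K).d * (((F.P K).L - 1) / 2) : ℕ) : ℝ))) ≤ 20 * ((F.P K).L : ℝ) ^ 4)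
    (U : GaugeField (F.P K) 0 (Matrix.specialUnitaryGroup (Fin 2) ℂ)) (gJ : GaugeTransf (F.P K) 0 (Matrix.specialUnitaryGroup (Fin 2) ℂ))
    (hInAk : InAk (F.P K).L (K - n) (((F.L : ℝ)⁻¹) ^ (K - n)) ε₀ (fun _ => (Set.univ : Set (LSite (F.P K).d)))
      (pull (unitsField (toUField (GaugeField.gaugeAct gJ U))) 0))
    (hInAx : ∀ m, m ≤ K - n → ∀ Λ : ℕ → Set (LSite (F.P K).d),
      InAx (F.P K).L m Λ (1 : LSite (F.P K).d → Fin (F.P K).d → (Matrix (Fin 2) (Fin 2) ℂ)ˣ) (pull (unitsField (toUField (GaugeField.gaugeAct gJ U))) 0))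
    (z : LSite (F.P K).d) (ν : Fin (F.P K).d) :
    ‖(((dbarIterU (K - n) (unitsField (toUField (GaugeField.gaugeAct gJ U))) ⟨coverAt (F.P K) (K - n) z, ν⟩)⁻¹ *
          avgIter (F.P K).L (pull (unitsField (toUField (GaugeField.gaugeAct gJ U))) 0) (K - n) z ν : (Matrix (Fin 2) (Fin 2) ℂ)ˣ) :
        Matrix (Fin 2) (Fin 2) ℂ) - 1‖ ≤
      240 * (C2 (F.P K).d + 40000 * (((F.P K).d : ℝ) + 2) ^ 2) *
        (((2 * ((F.P K).d * (F.P K).L) + 1) * ((F.P K).d * ((F.P K).L - 1) + (F.P K).L) : ℕ) : ℝ) ^ 2 * ε₀ ^ 2 :=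
  comb_eq_dbar_mul_defect_of_step_inAx F hnK hε₀ (by have := C1_pos (F.P K).d; unfold C2; positivity) (Nat.cast_nonneg _)
    (fun j hj2 => norm_dbarAvgU_inv_mul_bavg_sub_one_le hj2) hα3 hα2 hw1 hw2 hA U gJ hInAk hInAx z ν

/-- ★★ **LEMMA B-al-2 AT EVERY LEVEL (`hstep` discharged, constants pinned):** `‖(dbarIterU j X̂ ⟨π_j x, μ⟩)⁻¹ · avgIter L U′ j x μ − 1‖ ≤ 240·c₁·δc²·ε₀²·(Lʲ)⁴(Lᵏ)⁻⁴` for all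
`j ≤ k = K − n` — the per-level defect row `hdef` of the stair-size bricks; guards (a) `InAk`, (b) block-axiality. [cite: Balaban1985Averaging, (42)-(43) pp.23-24, (89) p.31, (127) p.36, Prop. 4 (134)-(135) pp.38-39; Balaban1987RG1, (0.4) p.253] -/
theorem comb_eq_dbar_mul_defect_levels (hnK : n < K) {ε₀ : ℝ} (hε₀ : 0 < ε₀)
    (hα3 : C0 (F.P K).d * (2 * ε₀) ≤ 1 / 3) (hα2 : 2 * (2 * ε₀) ≤ c2' (F.P K).d (F.P K).L)
    (hw1 : 10 ^ 4 * ((((F.P K).d + 2) * (F.P K).L : ℕ) : ℝ) *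
      ((((2 * ((F.P K).d * (F.P K).L) + 1) * ((F.P K).d * ((F.P K).L - 1) + (F.P K).L) : ℕ) : ℝ) * (4 * ε₀) +
        2 * (240 * (C2 (F.P K).d + 40000 * (((F.P K).d : ℝ) + 2) ^ 2) *
          (((2 * ((F.P K).d * (F.P K).L) + 1) * ((F.P K).d * ((F.P K).L - 1) + (F.P K).L) : ℕ) : ℝ) ^ 2 * ε₀ ^ 2)) ≤ 1)
    (hw2 : ((F.P K).L : ℝ) * (2 * ((((2 * ((F.P K).d * (F.P K).L) + 1) * ((F.P K).d * ((F.P K).L - 1) + (F.P K).L) : ℕ) : ℝ) * (4 * ε₀))) ≤ c4 (F.P K).d)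
    (hA : 33 * (2 * (((((F.P K).d + 2) * (F.P K).L : ℕ) : ℝ) + (F.P K).L + 2 * (((F.P K).d * (((F.P K).L - 1) / 2) : ℕ) : ℝ))) ≤ 20 * ((F.P K).L : ℝ) ^ 4)
    (U : GaugeField (F.P K) 0 (Matrix.specialUnitaryGroup (Fin 2) ℂ)) (gJ : GaugeTransf (F.P K) 0 (Matrix.specialUnitaryGroup (Fin 2) ℂ))
    (hInAk : InAk (F.P K).L (K - n) (((F.L : ℝ)⁻¹) ^ (K - n)) ε₀ (fun _ => (Set.univ : Set (LSite (F.P K).d)))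
      (pull (unitsField (toUField (GaugeField.gaugeAct gJ U))) 0))
    (hblk : ∀ m, m < K - n → ∀ (z : LSite (F.P K).d) (r : Fin (F.P K).d → Fin (F.P K).L),
      axialFn (avgIter (F.P K).L (pull (unitsField (toUField (GaugeField.gaugeAct gJ U))) 0) (K - n - (m + 1))) (((F.P K).L : ℤ) • z)
        (((F.P K).L : ℤ) • z + boxVec (F.P K).L r) = 1) :
    ∀ j, j ≤ K - n → ∀ (x : LSite (F.P K).d) (μ : Fin (F.P K).d),
      ‖(((dbarIterU j (unitsField (toUField (GaugeField.gaugeAct gJ U))) ⟨coverAt (F.P K) j x, μ⟩)⁻¹ *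
            avgIter (F.P K).L (pull (unitsField (toUField (GaugeField.gaugeAct gJ U))) 0) j x μ : (Matrix (Fin 2) (Fin 2) ℂ)ˣ) :
          Matrix (Fin 2) (Fin 2) ℂ) - 1‖ ≤
        240 * (C2 (F.P K).d + 40000 * (((F.P K).d : ℝ) + 2) ^ 2) *
            (((2 * ((F.P K).d * (F.P K).L) + 1) * ((F.P K).d * ((F.P K).L - 1) + (F.P K).L) : ℕ) : ℝ) ^ 2 * ε₀ ^ 2 *
          ((((F.P K).L : ℝ) ^ j) ^ 4 * ((((F.P K).L : ℝ) ^ (K - n))⁻¹) ^ 4) :=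
  comb_eq_dbar_mul_defect_levels_of_step F hnK hε₀ (by have := C1_pos (F.P K).d; unfold C2; positivity) (Nat.cast_nonneg _)
    (fun j hj2 => norm_dbarAvgU_inv_mul_bavg_sub_one_le hj2) hα3 hα2 hw1 hw2 hA U gJ hInAk hblk

/-- ★★ **The per-level row in the guard (b′)** `InAx` (w3-20520 g9's door letters). [cite: Balaban1985Averaging, (42)-(43) pp.23-24, (89) p.31, (127) p.36, Prop. 4 (134)-(135) pp.38-39; Balaban1987RG1, (0.4) p.253] -/
theorem comb_eq_dbar_mul_defect_levels_inAx (hnK : n < K) {ε₀ : ℝ} (hε₀ : 0 < ε₀)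
    (hα3 : C0 (F.P K).d * (2 * ε₀) ≤ 1 / 3) (hα2 : 2 * (2 * ε₀) ≤ c2' (F.P K).d (F.P K).L)
    (hw1 : 10 ^ 4 * ((((F.P K).d + 2) * (F.P K).L : ℕ) : ℝ) *
      ((((2 * ((F.P K).d * (F.P K).L) + 1) * ((F.P K).d * ((F.P K).L - 1) + (F.P K).L) : ℕ) : ℝ) * (4 * ε₀) +
        2 * (240 * (C2 (F.P K).d + 40000 * (((F.P K).d : ℝ) + 2) ^ 2) *
          (((2 * ((F.P K).d * (F.P K).L) + 1) * ((F.P K).d * ((F.P K).L - 1) + (F.P K).L) : ℕ) : ℝ) ^ 2 * ε₀ ^ 2)) ≤ 1)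
    (hw2 : ((F.P K).L : ℝ) * (2 * ((((2 * ((F.P K).d * (F.P K).L) + 1) * ((F.P K).d * ((F.P K).L - 1) + (F.P K).L) : ℕ) : ℝ) * (4 * ε₀))) ≤ c4 (F.P K).d)
    (hA : 33 * (2 * (((((F.P K).d + 2) * (F.P K).L : ℕ) : ℝ) + (F.P K).L + 2 * (((F.P K).d * (((F.P K).L - 1) / 2) : ℕ) : ℝ))) ≤ 20 * ((F.P K).L : ℝ) ^ 4)
    (U : GaugeField (F.P K) 0 (Matrix.specialUnitaryGroup (Fin 2) ℂ)) (gJ : GaugeTransf (F.P K) 0 (Matrix.specialUnitaryGroup (Fin 2) ℂ))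
    (hInAk : InAk (F.P K).L (K - n) (((F.L : ℝ)⁻¹) ^ (K - n)) ε₀ (fun _ => (Set.univ : Set (LSite (F.P K).d)))
      (pull (unitsField (toUField (GaugeField.gaugeAct gJ U))) 0))
    (hInAx : ∀ m, m ≤ K - n → ∀ Λ : ℕ → Set (LSite (F.P K).d),
      InAx (F.P K).L m Λ (1 : LSite (F.P K).d → Fin (F.P K).d → (Matrix (Fin 2) (Fin 2) ℂ)ˣ) (pull (unitsField (toUField (GaugeField.gaugeAct gJ U))) 0)) :
    ∀ j, j ≤ K - n → ∀ (x : LSite (F.P K).d) (μ : Fin (F.P K).d),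
      ‖(((dbarIterU j (unitsField (toUField (GaugeField.gaugeAct gJ U))) ⟨coverAt (F.P K) j x, μ⟩)⁻¹ *
            avgIter (F.P K).L (pull (unitsField (toUField (GaugeField.gaugeAct gJ U))) 0) j x μ : (Matrix (Fin 2) (Fin 2) ℂ)ˣ) :
          Matrix (Fin 2) (Fin 2) ℂ) - 1‖ ≤
        240 * (C2 (F.P K).d + 40000 * (((F.P K).d : ℝ) + 2) ^ 2) *
            (((2 * ((F.P K).d * (F.P K).L) + 1) * ((F.P K).d * ((F.P K).L - 1) + (F.P K).L) : ℕ) : ℝ) ^ 2 * ε₀ ^ 2 *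
          ((((F.P K).L : ℝ) ^ j) ^ 4 * ((((F.P K).L : ℝ) ^ (K - n))⁻¹) ^ 4) :=
  comb_eq_dbar_mul_defect_levels_of_step_inAx F hnK hε₀ (by have := C1_pos (F.P K).d; unfold C2; positivity) (Nat.cast_nonneg _)
    (fun j hj2 => norm_dbarAvgU_inv_mul_bavg_sub_one_le hj2) hα3 hα2 hw1 hw2 hA U gJ hInAk hInAx

end Summit.QuantumFields.YangMills.Theorems.HalvingCombTorusTowerOfStep

end
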